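import Literature.NumberTheory.EllipticCurves.LocalH1TateDualityLangTateProofs
import HarnessLib

/-!
# Lang–Tate's splitting criterion (global-class form) from the vanishing of unramified classes

Topic `NumberTheory/EllipticCurves`. `Proofs` file (theorems only; no definitions, no named
facts) for the named fact
`Literature.NumberTheory.EllipticCurves.LangTate1958_split_of_dvd_ramificationIdx` of
`PeriodIndex` — the "if" direction of the Lang–Tate splitting criterion in the form Clark–Sharif
2010, §3.7 (i) apply it: for an elliptic curve `E/K` over a number field, `η ∈ H¹(K, E)` killed by
`P > 0`, a finite place `v` of good reduction with `v ∤ P`, a finite extension `L/K` and a place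
`w ∣ v` of `L` with `P ∣ e(w ∣ v)`, the restriction `η|_L` is locally trivial at `w`.

Main result: **`LangTate1958_split_of_dvd_ramificationIdx_of_unramifiedClass_eq_zero`** —
`Milne2006_unramifiedClass_eq_zero → LangTate1958_split_of_dvd_ramificationIdx`: the fact is
reduced, with complete proofs, to the single classical input
`Literature.NumberTheory.EllipticCurves.Milne2006_unramifiedClass_eq_zero` (`PeriodIndexSupport`;
Milne, *Arithmetic Duality Theorems*, Prop. I.3.8: at a place of good reduction the unramified
classes of `H¹(K_v, E)` vanish — Lang's theorem), by composing the two reductions already in the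
tree:

* `LangTate1958_split_of_dvd_ramificationIdx_of_local` (`LocalH1TateDualityLangTate`): the
  global-class form follows from the local form `LangTate1958_cor1_local` (Lang–Tate 1958,
  Corollary 1 at a completion: a `P`-torsion class of `H¹(K_v, E)`, `v` good and prime to `P`,
  dies in `H¹(L_w, E)` when `P ∣ e(w ∣ v)`), by restricting `η` to `K_v` and comparing the two
  local conditions at `w`;
* `LangTate1958_cor1_local_of_unramifiedClass_eq_zero` (`LocalH1TateDualityLangTateProofs`):
  the local form follows from `Milne2006_unramifiedClass_eq_zero` (Kummer lift to `H¹(K_v, E[P])`,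
  inertia acts trivially on `E[P]`, tame inertia and the Kummer character `θ_P`, `P ∣ e` kills
  `θ_P` on the inertia of `L_w`, then Lang's theorem over `L_w`).

The discharge **`LangTate1958_split_of_dvd_ramificationIdx_holds`** is then the one-line
application of the main result of this file to the discharged input
`Milne2006_unramifiedClass_eq_zero_holds` (`PeriodIndexSupportProofs`: Milne ADT I.3.8 proved
from Lang's theorem on the special fibre and successive approximation in the kernel of
reduction over the unramified layers).

## References

* [ClarkSharif2010] P. L. Clark, S. Sharif, *Period, index and potential Ш*, Algebra & Number
  Theory 4 (2010) 151–174, §3.7 (i) (p. 13 of arXiv:0811.3019: "(Lang-Tate [LT]) […] a finite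
  extension field `F'/F` splits a genus one curve `C/F` if and only if the period `P` of `C`
  divides the relative ramification index `e(F'/F)`. This will be used in the proof.") —
  doi:10.2140/ant.2010.4.151.
* [LangTate1958] S. Lang, J. Tate, *Principal homogeneous spaces over abelian varieties*, Amer.
  J. Math. 80 (1958) 659–684, Corollary 1 — doi:10.2307/2372778 (not held; statement as reported
  in [ClarkSharif2010] §3.7 (i), [Clark2006Crelle] §3 and [Matsuno2009] proof of Lemma 4.2).
* [MilneADT2006] J. S. Milne, *Arithmetic Duality Theorems*, 2nd ed. (2006), Ch. I Prop. 3.8.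

## Design

One universe `u` (as in the three named facts involved). No new declarations besides the
reduction theorem and the discharge; axioms `propext`, `Classical.choice`, `Quot.sound`
(inherited).
-/

universe u

namespace Literature.NumberTheory.EllipticCurves

/-- **Lang–Tate's splitting criterion ("if" direction, global-class form) from Milne ADT I.3.8.**
The named fact `LangTate1958_split_of_dvd_ramificationIdx` (`η ∈ H¹(K, E)[P]`, `v` good with
`v ∤ P`, `w ∣ v` with `P ∣ e(w ∣ v)` ⟹ `η|_L` is locally trivial at `w`) follows from the vanishing
of unramified classes at good reduction (`Milne2006_unramifiedClass_eq_zero`), through the local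
form `LangTate1958_cor1_local`: compose `LangTate1958_cor1_local_of_unramifiedClass_eq_zero`
with `LangTate1958_split_of_dvd_ramificationIdx_of_local`.
[cite: ClarkSharif2010, §3.7 (i) (reporting LangTate1958, Corollary 1)]
[cite: MilneADT2006, Ch. I Prop. 3.8] -/
theorem LangTate1958_split_of_dvd_ramificationIdx_of_unramifiedClass_eq_zero
    (hM : Milne2006_unramifiedClass_eq_zero.{u}) :
    LangTate1958_split_of_dvd_ramificationIdx.{u} :=
  LangTate1958_split_of_dvd_ramificationIdx_of_local
    (LangTate1958_cor1_local_of_unramifiedClass_eq_zero hM)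

/-- **Lang–Tate's splitting criterion ("if" direction, global-class form) — discharge of the
named fact `LangTate1958_split_of_dvd_ramificationIdx`.** For an elliptic curve `E/K` over a
number field, a class `η ∈ H¹(K, E)` with `P • η = 0` (`P > 0`), a finite place `v` of good
reduction with `(P) ⊄ v`, a finite extension `L/K` and a place `w ∣ v` of `L` with
`P ∣ e(w ∣ v)`, the restriction `η|_L ∈ H¹(L, E)` lies in the kernel of the localisation at `w`.
Proof: `LangTate1958_split_of_dvd_ramificationIdx_of_unramifiedClass_eq_zero` (this file: the
global-class form from the local form `LangTate1958_cor1_local`, itself from the vanishing of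
unramified classes at good reduction) fed with the discharged input
`Milne2006_unramifiedClass_eq_zero_holds` (`PeriodIndexSupportProofs`; Milne, *Arithmetic Duality
Theorems*, Prop. I.3.8). Equivalently `LangTate1958_split_of_dvd_ramificationIdx_of_local
LangTate1958_cor1_local_holds` (`LocalH1TateDualityLangTateProofs`).
[cite: ClarkSharif2010, §3.7 (proof of Theorem 3), item (i), reporting LangTate1958, Corollary 1]
[cite: MilneADT2006, Ch. I Prop. 3.8] -/
theorem LangTate1958_split_of_dvd_ramificationIdx_holds :
    LangTate1958_split_of_dvd_ramificationIdx.{u} :=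
  LangTate1958_split_of_dvd_ramificationIdx_of_unramifiedClass_eq_zero
    Milne2006_unramifiedClass_eq_zero_holds

end Literature.NumberTheory.EllipticCurves
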